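import Summits.HubbardSuperconductivity.HubbardSuperconductivity.Theorems.AnisotropyChordTransferFibre3RowDPairZ
import Summits.HubbardSuperconductivity.HubbardSuperconductivity.Theorems.AnisotropyChordTransferFibre3RowDBoundaryLines
import Summits.HubbardSuperconductivity.HubbardSuperconductivity.Theorems.AnisotropyChordTransferFibre3FinXDYfun
import Summits.HubbardSuperconductivity.HubbardSuperconductivity.Theorems.AnisotropyChordTransferFibre3GroundFormulas

/-!
# Route `AnisotropyChord` / H0 rotor rung, row D (KT-2a) Stage-1 evaluator: the `D`-BOUNDARY LINES of a monomial, SPLIT (semantic)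

Layer F2a of the row-D program (p1 g29 memo ROWD-DESIGN-g29 §6).  g27's `BoundaryLines` writes the three `D`-line sums of `OffDTransform`
(for `G = v·c0form3 + mform3` of a monomial `(Fa,Fb,Fc) = (slot k1, slot k2, slot k3)`) as the nine-term combination of `bCA, bMA, bCB, bMB,
bCD, bMD`, each a sum of (point value of a slot at a nearest neighbour) × (pair transform `Z`).  For the ground profile the point values are
constants already in the row-D box: ★ `slot_nn : slot JU (±e) = a`, `slot S (±e) = η_eff` (`f(x̂) = a + η_eff`, `ManifoldA.manifold_dictionary`;
`G̃` equal on the four neighbours, `FinXD.Gres_dirs`), and every `Z` is `closed2U + loop2U` of two typed specs (`…RowDPairZ`).  Hence, with the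
GENERIC functional ★ `bLinesG Z2 k3 k1 k2 (pv₁ pv₂ pv₃) k₂ k₃` (the nine-term combination with `Z ↦ Z2 ψ ψ′`), ★ `bdry_lines_eq :
Σ_{D-lines} = bLinesG (closed2U + loop2U)` and ★ `bLinesG_add` (linearity) ⇒ ★ `bdry_split : Σ_{D-lines}(k₂,k₃) = bClosedU + bLoopU`.
(The `RExpr` pair `bTermE` evaluating `bClosedU/(V²t) = bClosedU/V/(4π²)` is layer F2b.)
Prover seat `hubbard-h0-rotor-p1` g29 (route lead); helper for piece A = stmt-HubbardSuperconductivity-23918 of rung 19089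
(`--supports`, helper class).  Nothing here proves superconductivity in the Hubbard model; lemmas for ONE row of ONE conditional reduction;
the rotor TARGET as originally worded stays FALSE (g15 verdict).  Tree imports only; no sorry.
-/

set_option linter.dupNamespace false
set_option autoImplicit false

open Literature.Analysis.ValidatedNumerics

namespace Summit.HubbardSuperconductivity.HubbardSuperconductivity.Theorems.AnisotropyChord.Transfer.Fibre3

namespace RowD

open RowC L2.N1

variable (L : ℕ) [NeZero L]

/-! ## Point values of the slots at the nearest neighbours -/

section pointvalues
variable (Δ lam2 : ℝ) (f : Tor L → ℝ)

/-- the point value of a slot at any nearest neighbour: `JU ↦ a`, `S ↦ η_eff`. -/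
noncomputable def pvR (kind : Bool) : ℝ := if kind then etaEff L lam2 else Δ * f (K1 L)

/-- the four neighbours are nonzero (`L ≥ 7`). -/
theorem nn_ne_zero (hL : 7 ≤ L) : ex L ≠ 0 ∧ -ex L ≠ 0 ∧ ey L ≠ 0 ∧ -ey L ≠ 0 := by
  obtain ⟨hex, hnex, hey, hney, -⟩ := toTor_named L
  have h := fun (q : ℤ × ℤ) (hq : q ∈ gridPts 3) (hz : B1.toTor L q = 0) =>
    ne_zero_of_grid q hq ((toTor_eq_zero_iff L hL (Or.inr hq)).mp hz)
  refine ⟨?_, ?_, ?_, ?_⟩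
  · rw [← hex]; exact fun hz => h (1, 0) (by decide) hz
  · rw [← hnex]; exact fun hz => h (-1, 0) (by decide) hz
  · rw [← hey]; exact fun hz => h (0, 1) (by decide) hz
  · rw [← hney]; exact fun hz => h (0, -1) (by decide) hz

/-- the ground profile takes the value `f(x̂) = a + η_eff` on all four neighbours (`L ≥ 7`, `0 ≤ Δ < 1`). -/
theorem f_nn (hL : 7 ≤ L) (hΔ0 : 0 ≤ Δ) (hΔ1 : Δ < 1) (hf : IsGroundTwoMagnon L Δ lam2 f) :
    f (ex L) = Δ * f (K1 L) + etaEff L lam2 ∧ f (-ex L) = Δ * f (K1 L) + etaEff L lam2 ∧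
    f (ey L) = Δ * f (K1 L) + etaEff L lam2 ∧ f (-ey L) = Δ * f (K1 L) + etaEff L lam2 := by
  have hL5 : 5 ≤ L := by omega
  obtain ⟨h1, -⟩ := ManifoldA.manifold_dictionary L hL5 hΔ0 hΔ1 hf
  obtain ⟨hx, hnx, hy, hny⟩ := nn_ne_zero L hL
  obtain ⟨g1, g2, g3⟩ := FinXD.Gres_dirs L lam2
  have px := ground_profile_eq L hL5 hΔ0 hΔ1 hf hx
  have pnx := ground_profile_eq L hL5 hΔ0 hΔ1 hf hnx
  have py := ground_profile_eq L hL5 hΔ0 hΔ1 hf hy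
  have pny := ground_profile_eq L hL5 hΔ0 hΔ1 hf hny
  -- `K1 L = ex L` definitionally
  have h1' : f (ex L) = Δ * f (K1 L) + etaEff L lam2 := h1
  refine ⟨h1', ?_, ?_, ?_⟩
  · rw [pnx, g1, ← px]; exact h1'
  · rw [py, g2, ← px]; exact h1'
  · rw [pny, g3, ← px]; exact h1'

/-- ★ slot point values at the neighbours: `slot kind (±x̂) = slot kind (±ŷ) = pvR kind`. -/
theorem slot_nn (hL : 7 ≤ L) (hΔ0 : 0 ≤ Δ) (hΔ1 : Δ < 1) (hf : IsGroundTwoMagnon L Δ lam2 f) (kind : Bool) :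
    slot L Δ f kind (ex L) = pvR L Δ lam2 f kind ∧ slot L Δ f kind (-ex L) = pvR L Δ lam2 f kind ∧
    slot L Δ f kind (ey L) = pvR L Δ lam2 f kind ∧ slot L Δ f kind (-ey L) = pvR L Δ lam2 f kind := by
  obtain ⟨hx, hnx, hy, hny⟩ := nn_ne_zero L hL
  obtain ⟨fx, fnx, fy, fny⟩ := f_nn L Δ lam2 f hL hΔ0 hΔ1 hf
  cases kind
  · simp only [slot, pvR, if_false, Bool.false_eq_true, fJU, hx, hnx, hy, hny, if_false, and_self]
  · simp only [slot, pvR, if_true, fS, fJU, hx, hnx, hy, hny, if_false]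
    refine ⟨?_, ?_, ?_, ?_⟩ <;> linarith

end pointvalues

/-! ## The generic nine-term boundary functional -/

section generic
variable (Δ lam2 : ℝ) (f : Tor L → ℝ)

/-- the `D`-boundary combination of `BoundaryLines` with every pair transform replaced by a two-spec functional `Z2 ψ ψ′ q` and the
nearest-neighbour point values by constants `p₁ p₂ p₃` (slots `a ↦ k1`, `b ↦ k2`, `b−a ↦ k3`). -/
noncomputable def bLinesG (Z2 : (Tor L × ℝ × ℝ × ℝ × ℝ × ℝ) → (Tor L × ℝ × ℝ × ℝ × ℝ × ℝ) → Tor L → ℂ)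
    (k3 k1 k2 : Bool) (p₁ p₂ p₃ : ℝ) (k₂ k₃ : Tor L) : ℂ :=
  let ψ : Bool → ℝ → ℝ → Tor L → (Tor L × ℝ × ℝ × ℝ × ℝ × ℝ) := fun k u u' e => psiU L Δ lam2 f k u u' e
  let CA : Tor L → ℂ := fun q => (1 / 2) * ((nnList L).map (fun e =>
      ((p₁ : ℝ) : ℂ) * Z2 (ψ k3 1 0 e) (ψ k2 1 (-1) e) q + ((p₁ : ℝ) : ℂ) * Z2 (ψ k2 1 0 e) (ψ k3 1 (-1) e) q)).sum
  let MA : Tor L → ℂ := fun q => -(1 / 2) * (([ex L, -(ex L)] : List (Tor L)).map (fun e => (phase L (K1 L) e - 1) *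
      (((p₁ : ℝ) : ℂ) * Z2 (ψ k2 0 1 e) (ψ k3 1 0 e) q + ((p₁ : ℝ) : ℂ) * Z2 (ψ k2 1 0 e) (ψ k3 0 1 e) q))).sum
  let CB : Tor L → ℂ := fun q => (1 / 2) * ((nnList L).map (fun e =>
      ((p₂ : ℝ) : ℂ) * (Z2 (ψ k3 1 0 e) (ψ k1 1 (-1) e) q + Z2 (ψ k1 1 0 (-e)) (ψ k3 1 (-1) (-e)) q))).sum
  let MB : Tor L → ℂ := fun q => -(1 / 2) * (([ex L, -(ex L)] : List (Tor L)).map (fun e => (phase L (K1 L) e - 1) *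
      (((p₂ : ℝ) : ℂ) * Z2 (ψ k1 0 1 e) (ψ k3 1 0 e) q + ((p₂ : ℝ) : ℂ) * Z2 (ψ k1 1 0 e) (ψ k3 0 1 e) q))).sum
  let CD : Tor L → ℂ := fun q => (1 / 2) * ((nnList L).map (fun e =>
      ((p₃ : ℝ) : ℂ) * (Z2 (ψ k2 1 0 (-e)) (ψ k1 1 (-1) (-e)) q + Z2 (ψ k1 1 0 e) (ψ k2 1 (-1) e) q))).sum
  let MD : Tor L → ℂ := fun q => -(1 / 2) * (([ex L, -(ex L)] : List (Tor L)).map (fun e => (phase L (K1 L) e - 1) *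
      (((p₃ : ℝ) : ℂ) * Z2 (ψ k1 0 1 (-e)) (ψ k2 1 0 e) q + ((p₃ : ℝ) : ℂ) * Z2 (ψ k1 1 0 e) (ψ k2 0 1 (-e)) q))).sum
  (2 * CA k₃ + CA (k₃ - K1 L) + MA k₃) + (2 * CB k₂ + CB (k₂ - K1 L) + MB k₂)
    + (CD (k₂ + k₃) + 2 * CD (k₂ + k₃ - K1 L) + MD (k₂ + k₃ - K1 L))

omit [NeZero L] in
/-- ★ linearity of the boundary functional in `Z2`. -/
theorem bLinesG_add (Z Z' : (Tor L × ℝ × ℝ × ℝ × ℝ × ℝ) → (Tor L × ℝ × ℝ × ℝ × ℝ × ℝ) → Tor L → ℂ)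
    (k3 k1 k2 : Bool) (p₁ p₂ p₃ : ℝ) (k₂ k₃ : Tor L) :
    bLinesG L Δ lam2 f (fun ψ ψ' q => Z ψ ψ' q + Z' ψ ψ' q) k3 k1 k2 p₁ p₂ p₃ k₂ k₃
      = bLinesG L Δ lam2 f Z k3 k1 k2 p₁ p₂ p₃ k₂ k₃ + bLinesG L Δ lam2 f Z' k3 k1 k2 p₁ p₂ p₃ k₂ k₃ := by
  unfold bLinesG
  simp only [nnList, List.map, List.sum_cons, List.sum_nil]
  ring

/-- the closed half of the boundary lines. -/
noncomputable def bClosedU (k3 k1 k2 : Bool) (k₂ k₃ : Tor L) : ℂ :=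
  bLinesG L Δ lam2 f (closed2U L lam2) k3 k1 k2 (pvR L Δ lam2 f k1) (pvR L Δ lam2 f k2) (pvR L Δ lam2 f k3) k₂ k₃

/-- the loop half of the boundary lines (two-propagator primitives; majorised in Stage-1b). -/
noncomputable def bLoopU (k3 k1 k2 : Bool) (k₂ k₃ : Tor L) : ℂ :=
  bLinesG L Δ lam2 f (loop2U L lam2) k3 k1 k2 (pvR L Δ lam2 f k1) (pvR L Δ lam2 f k2) (pvR L Δ lam2 f k3) k₂ k₃

/-- ★ THE BOUNDARY LINES OF A MONOMIAL in generic form: `BoundaryLines`' nine-term combination for `(slot k1, slot k2, slot k3)` equals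
`bLinesG (closed2U + loop2U)` (ground profile, `L ≥ 7`, `0 ≤ Δ < 1`). -/
theorem bdry_lines_eq (hL : 7 ≤ L) (hΔ0 : 0 ≤ Δ) (hΔ1 : Δ < 1) (hf : IsGroundTwoMagnon L Δ lam2 f)
    (k3 k1 k2 : Bool) (k₂ k₃ : Tor L) :
    (2 * bCA L (slot L Δ f k1) (slot L Δ f k2) (slot L Δ f k3) k₃ + bCA L (slot L Δ f k1) (slot L Δ f k2) (slot L Δ f k3) (k₃ - K1 L)
        + bMA L (slot L Δ f k1) (slot L Δ f k2) (slot L Δ f k3) k₃)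
      + (2 * bCB L (slot L Δ f k1) (slot L Δ f k2) (slot L Δ f k3) k₂ + bCB L (slot L Δ f k1) (slot L Δ f k2) (slot L Δ f k3) (k₂ - K1 L)
        + bMB L (slot L Δ f k1) (slot L Δ f k2) (slot L Δ f k3) k₂)
      + (bCD L (slot L Δ f k1) (slot L Δ f k2) (slot L Δ f k3) (k₂ + k₃)
        + 2 * bCD L (slot L Δ f k1) (slot L Δ f k2) (slot L Δ f k3) (k₂ + k₃ - K1 L)
        + bMD L (slot L Δ f k1) (slot L Δ f k2) (slot L Δ f k3) (k₂ + k₃ - K1 L))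
      = bLinesG L Δ lam2 f (fun ψ ψ' q => closed2U L lam2 ψ ψ' q + loop2U L lam2 ψ ψ' q) k3 k1 k2
          (pvR L Δ lam2 f k1) (pvR L Δ lam2 f k2) (pvR L Δ lam2 f k3) k₂ k₃ := by
  have hL5 : 5 ≤ L := by omega
  -- point values
  obtain ⟨a1, a2, a3, a4⟩ := slot_nn L Δ lam2 f hL hΔ0 hΔ1 hf k1
  obtain ⟨b1, b2, b3, b4⟩ := slot_nn L Δ lam2 f hL hΔ0 hΔ1 hf k2
  obtain ⟨c1, c2, c3, c4⟩ := slot_nn L Δ lam2 f hL hΔ0 hΔ1 hf k3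
  -- pair transforms
  have ZsD := pairZ_slot_D L Δ lam2 f hL5 hΔ0 hΔ1 hf
  have ZhS := pairZ_shift_slot L Δ lam2 f hL5 hΔ0 hΔ1 hf
  have ZSh := pairZ_slot_shift L Δ lam2 f hL5 hΔ0 hΔ1 hf
  have ZpS := pairZ_shiftp_slot L Δ lam2 f hL5 hΔ0 hΔ1 hf
  have ZSp := pairZ_slot_shiftp L Δ lam2 f hL5 hΔ0 hΔ1 hf
  unfold bCA bMA bCB bMB bCD bMD bLinesG
  simp only [nnList, List.map, List.sum_cons, List.sum_nil, neg_neg, ZsD, ZhS, ZSh, ZpS, ZSp]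
  -- the nearest-neighbour literals are `±ex`, `±ey`
  have e1 : (((1 : ZMod L), (0 : ZMod L)) : Tor L) = ex L := rfl
  have e2 : (((-1 : ZMod L), (0 : ZMod L)) : Tor L) = -ex L := by simp [ex]
  have e3 : (((0 : ZMod L), (1 : ZMod L)) : Tor L) = ey L := rfl
  have e4 : (((0 : ZMod L), (-1 : ZMod L)) : Tor L) = -ey L := by simp [ey]
  simp only [e1, e2, e3, e4, neg_neg, a1, a2, a3, a4, b1, b2, b3, b4, c1, c2, c3, c4]

/-- ★ THE SPLIT: `Σ_{D-lines}(k₂,k₃) = bClosedU + bLoopU`. -/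
theorem bdry_split (hL : 7 ≤ L) (hΔ0 : 0 ≤ Δ) (hΔ1 : Δ < 1) (hf : IsGroundTwoMagnon L Δ lam2 f)
    (k3 k1 k2 : Bool) (k₂ k₃ : Tor L) :
    (2 * bCA L (slot L Δ f k1) (slot L Δ f k2) (slot L Δ f k3) k₃ + bCA L (slot L Δ f k1) (slot L Δ f k2) (slot L Δ f k3) (k₃ - K1 L)
        + bMA L (slot L Δ f k1) (slot L Δ f k2) (slot L Δ f k3) k₃)
      + (2 * bCB L (slot L Δ f k1) (slot L Δ f k2) (slot L Δ f k3) k₂ + bCB L (slot L Δ f k1) (slot L Δ f k2) (slot L Δ f k3) (k₂ - K1 L)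
        + bMB L (slot L Δ f k1) (slot L Δ f k2) (slot L Δ f k3) k₂)
      + (bCD L (slot L Δ f k1) (slot L Δ f k2) (slot L Δ f k3) (k₂ + k₃)
        + 2 * bCD L (slot L Δ f k1) (slot L Δ f k2) (slot L Δ f k3) (k₂ + k₃ - K1 L)
        + bMD L (slot L Δ f k1) (slot L Δ f k2) (slot L Δ f k3) (k₂ + k₃ - K1 L))
      = bClosedU L Δ lam2 f k3 k1 k2 k₂ k₃ + bLoopU L Δ lam2 f k3 k1 k2 k₂ k₃ := by
  rw [bdry_lines_eq L Δ lam2 f hL hΔ0 hΔ1 hf, bLinesG_add]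
  rfl

end generic

end RowD

end Summit.HubbardSuperconductivity.HubbardSuperconductivity.Theorems.AnisotropyChord.Transfer.Fibre3
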